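import Summits.HodgeConjecture.HodgeConjecture.Theorems.NikulinTwinTransportSquareKunneth
import Summits.HodgeConjecture.HodgeConjecture.Theorems.NikulinTwinTransportSquareGlueActions
import Literature.AlgebraicGeometry.HodgeTheory.GysinBaseChange
import Literature.AlgebraicGeometry.HodgeTheory.AlgebraicClassesExteriorProduct
import Literature.AlgebraicGeometry.HodgeTheory.TopDegreeClasses
import Literature.AlgebraicGeometry.Surfaces.K3MarkingProofs
import Literature.AlgebraicGeometry.Surfaces.K3SurfaceProofs
import Mathlib.LinearAlgebra.BilinearForm.Orthogonal

/-!
# Route NikulinTwinTransport · frame item `Assembly` (stmt-HodgeConjecture-13942) —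
# the square of a surface all of whose degree-2 classes are algebraic

Helper toward the frame item. If `S` is a smooth projective surface with `H¹(S(ℂ); ℂ) = 0` whose
algebraic divisor classes exhaust `H²(S(ℂ); ℂ)` (`algebraicClasses S 1 = ⊤`), then EVERY class of
even degree on `(S ⊗ S)(ℂ)` is algebraic — the cycle part of the Hodge conjecture for `S ⊗ S`
holds with room to spare (classical for surfaces with `p_g = q = 0`; here it is the degenerate
branch `e(σ) = 0` of the sector `SquareHodgeOfSqrtTwo`, where the hypotheses force
`NS(S)^⊥ = 0`). Proof: the Künneth normal forms of the tree (`kunneth_two`, `kunneth_four`,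
`kunneth_six`, fed with the PROVED Künneth spanning property `kunnethSpan_complexBetti`), exterior
products and pull-backs of algebraic classes are algebraic
(`cupProduct_map_fst_map_snd_mem_algebraicClasses`, `map_fst_mem_algebraicClasses`,
`map_snd_mem_algebraicClasses` of `…SquareGlueActions`), top-degree classes are algebraic
(`mem_algebraicClasses_of_degree_top`), and `H^{>8}((S ⊗ S)(ℂ)) = 0`.

No new definitions, no named facts. Prover seat prover-pitem-stmt-HodgeConjecture-13942-0.
-/

noncomputable section

namespace Summit.HodgeConjecture.HodgeConjecture.Theorems.NikulinTwinTransport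

open CategoryTheory MonoidalCategory CartesianMonoidalCategory
open Literature.AlgebraicGeometry.Motives Literature.AlgebraicGeometry.HodgeTheory
open Literature.AlgebraicGeometry.Surfaces
open Literature.AlgebraicTopology.SingularHomology

variable {S : SchemeOver ℂ}

/-- **If all of `H²(S(ℂ); ℂ)` is algebraic and `H¹(S(ℂ); ℂ) = 0`, every even-degree class on
`(S ⊗ S)(ℂ)` is algebraic.** Degree `0`: `N⁰ = H⁰`. Degree `2`: `fst^* a + snd^* b`
(`kunneth_two`). Degree `4`: `Σᵢ fst^* vᵢ ∪ snd^* uᵢ + t₄ • snd^* p + t₀ • fst^* p` (`kunneth_four`),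
exterior products of divisor classes and pull-backs of the (algebraic, top-degree) point class.
Degree `6`: `fst^* a ∪ snd^* p + fst^* p ∪ snd^* b` (`kunneth_six`). Degree `8`: top degree of the
fourfold `S ⊗ S`. Degrees `> 8`: zero. [folklore] [cite: HatcherAT2002, §3.2 Thm. 3.16]
[cite: VoisinHodgeII2003, Prop. 9.20] -/
theorem mem_algebraicClasses_square_of_algebraicClasses_one_eq_top (μ : OrientationFamily)
    (hS : IsSmoothProjective 2 S) [Subsingleton (complexBetti S 1)]
    (hN : algebraicClasses S 1 = ⊤) (p : ℕ) (c : complexBetti (S ⊗ S) (2 * p)) :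
    c ∈ algebraicClasses (S ⊗ S) p := by
  have hKS := kunnethSpan_complexBetti hS hS
  have hSS : IsSmoothProjective 4 (S ⊗ S) := IsSmoothProjective.tensor_holds hS hS
  -- the non-zero (integral) generator of `H⁴(S(ℂ); ℂ)`, algebraic as a top-degree class
  obtain ⟨p₀, hp₀, -, -⟩ := exists_isIntegralClass_generator_top hS
  have hp₀alg : p₀ ∈ algebraicClasses S 2 := mem_algebraicClasses_of_degree_top hS (by norm_num) p₀
  have hall : ∀ a : complexBetti S (2 * 1), a ∈ algebraicClasses S 1 := fun a => by
    rw [hN]; exact Submodule.mem_top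
  rcases Nat.lt_or_ge p 5 with hp | hp
  · interval_cases p
    · -- degree 0
      rw [algebraicClasses_zero]; exact Submodule.mem_top
    · -- degree 2
      obtain ⟨a, b, rfl⟩ := kunneth_two μ hS hKS c
      exact Submodule.add_mem _ (map_fst_mem_algebraicClasses hS hS (hall a))
        (map_snd_mem_algebraicClasses hS hS (hall b))
    · -- degree 4: a finite basis of `H²(S(ℂ); ℂ)` for the normal form
      letI := hS.chartedSpace
      haveI := ComplexPoints.compactSpace_of_isSmoothProjective hS
      haveI := ComplexPoints.t2Space_of_isSmoothProjective hS
      haveI : Module.Finite ℂ (complexBetti S (2 * 1)) :=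
        finite_singularCohomology_of_compact_chartedSpace ℂ ℂ (d := 2 * 2) (2 * 1)
      let v := Module.finBasis ℂ (complexBetti S (2 * 1))
      obtain ⟨u, t₄, t₀, rfl⟩ := kunneth_four μ hS hKS hp₀ v c
      refine Submodule.add_mem _ (Submodule.add_mem _ (Submodule.sum_mem _ fun i _ => ?_) ?_) ?_
      · exact cupProduct_map_fst_map_snd_mem_algebraicClasses hS hS (l := 1) (k := 1) (hall _) (hall _)
      · exact Submodule.smul_mem _ _ (map_snd_mem_algebraicClasses hS hS hp₀alg)
      · exact Submodule.smul_mem _ _ (map_fst_mem_algebraicClasses hS hS hp₀alg)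
    · -- degree 6
      obtain ⟨a, b, rfl⟩ := kunneth_six μ hS hKS hp₀ c
      refine Submodule.add_mem _ ?_ ?_
      · exact cupProduct_map_fst_map_snd_mem_algebraicClasses hS hS (l := 1) (k := 2) (hall a) hp₀alg
      · exact cupProduct_map_fst_map_snd_mem_algebraicClasses hS hS (l := 2) (k := 1) hp₀alg (hall b)
    · -- degree 8 (top degree of `S ⊗ S`)
      exact mem_algebraicClasses_of_degree_top hSS (by norm_num) c
  · -- degrees `> 8`
    haveI := ComplexPoints.subsingleton_singularCohomology_of_lt hSS ℂ (k := 2 * p) (by omega)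
    rw [Subsingleton.elim c 0]
    exact Submodule.zero_mem _


/-! ### All of `H²` is algebraic as soon as nothing is transcendental -/

/-- **If no non-zero class of `H²(S(ℂ); ℂ)` is orthogonal to all divisor classes, then every class
is a divisor class**: read through a marking `η` (`a ∪ b = (ηa.ηb) • p`), the cup form is
the non-degenerate symmetric K3 form, for which `N = (N^⊥)^⊥ = 0^⊥ = H²`.
[cite: Huybrechts2016K3, Ch. 14 §0.3 (vi)] -/
theorem algebraicClasses_one_eq_top_of_forall_orthogonal_eq_zero
    (η : complexBetti S (2 * 1) ≃ₗ[ℂ] (K3Index → ℂ)) {p : complexBetti S (2 * 2)}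
    (hcup : ∀ a b : complexBetti S (2 * 1),
      cupProduct (rfl : 2 * 1 + 2 * 1 = 2 * 2) a b = k3Form (η a) (η b) • p)
    (hT0 : ∀ x : complexBetti S (2 * 1),
      (∀ d ∈ algebraicClasses S 1, cupProduct (rfl : 2 * 1 + 2 * 1 = 2 * 2) x d = 0) → x = 0) :
    algebraicClasses S 1 = ⊤ := by
  haveI : FiniteDimensional ℂ (complexBetti S (2 * 1)) := LinearEquiv.finiteDimensional η.symm
  -- the cup form read through the marking
  let B : LinearMap.BilinForm ℂ (complexBetti S (2 * 1)) := k3FormC.compl₁₂ η.toLinearMap η.toLinearMap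
  have hB : ∀ x y, B x y = k3Form (η x) (η y) := fun x y => by
    simp only [B, LinearMap.compl₁₂_apply, LinearEquiv.coe_coe, k3FormC_apply]
  have hBsymm : B.IsSymm := ⟨fun x y => by rw [hB, hB, k3Form_comm]⟩
  have hBnd : B.Nondegenerate := by
    refine (LinearMap.IsRefl.nondegenerate_iff_separatingLeft hBsymm.isRefl).2 fun x hx => ?_
    have hdet : (k3Gram.map (Int.cast : ℤ → ℂ)).det ≠ 0 := by
      rw [← Int.cast_det, k3Gram_det]; norm_num
    have hnd : k3FormC.Nondegenerate :=
      LinearMap.BilinForm.nondegenerate_toBilin'_of_det_ne_zero' _ hdet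
    have h : η x = 0 := by
      refine (LinearMap.IsRefl.nondegenerate_iff_separatingLeft k3FormC_isSymm.isRefl).1 hnd (η x)
        fun w => ?_
      have := hx (η.symm w)
      rwa [hB, LinearEquiv.apply_symm_apply, ← k3FormC_apply] at this
    simpa using h
  -- `N^⊥ = 0` for `B`
  have horth : B.orthogonal (algebraicClasses S 1) = ⊥ := by
    rw [eq_bot_iff]
    intro x hx
    rw [LinearMap.BilinForm.mem_orthogonal_iff] at hx
    rw [Submodule.mem_bot]
    refine hT0 x fun d hd => ?_
    have h := hx d hd
    rw [hB, k3Form_comm] at h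
    rw [hcup, h, zero_smul]
  rw [← LinearMap.BilinForm.orthogonal_orthogonal hBnd hBsymm.isRefl (algebraicClasses S 1), horth,
    LinearMap.BilinForm.orthogonal_bot]

/-- **The Hodge conjecture for `S ⊗ S` when all of `H²(S(ℂ); ℂ)` is algebraic** (`S` a smooth
projective surface with `b₁ = 0`), granted a Hodge model of the product for the anti-vacuity
conjunct of `HodgeConjectureFor`. [folklore] [cite: VoisinHodgeII2003, Prop. 9.20] -/
theorem hodgeConjectureFor_square_of_algebraicClasses_one_eq_top (μ : OrientationFamily)
    (hS : IsSmoothProjective 2 S) [Subsingleton (complexBetti S 1)]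
    (hN : algebraicClasses S 1 = ⊤) (hM : Nonempty (HodgeModel 4 (S ⊗ S))) :
    HodgeConjectureFor 4 (S ⊗ S) :=
  ⟨hM, fun p c _ _ => mem_algebraicClasses_square_of_algebraicClasses_one_eq_top μ hS hN p c⟩

end Summit.HodgeConjecture.HodgeConjecture.Theorems.NikulinTwinTransport

end
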